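import Mathlib

/-!
# (M8) THE SMALL-CIRCLE LIMIT, QUANTITATIVE (nsreg-p2 g37 ROUND-47 «WHO HOLDS THE RIDGE» §1/§4, plate t50-M8; text
`r47/Sketch47.lean` sha16 fea44084dd39e0a7, Prop `NsregP2.R47.SmallCircleLimit`, binder-for-binder)

Width piece for crux `EulerZoomLiouville.PowerGaugeEulerLiouville` (stmt-NavierStokesRegularity-19832), by name under LEAD 19832
(ns-typeII-p2); seat ns-sfl-p1 g7 (K⁗ assembler), `--supports stmt-NavierStokesRegularity-19832 --as helper`.

For `C¹` maps `p : ℂ → ℝ`, `v : ℂ → ℂ` whose derivatives are bounded by `Lp`, `Lv` on the closed disc of radius `δ > 0` about `0`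
(`r̂(z) = z/‖z‖`, `v_r = ⟪v, r̂⟫` the radial component, `⨍_{S_δ}` the circle average `Real.circleAverage · 0 δ`):
* `|⨍_{S_δ} p − p(0)| ≤ δ·Lp` (mean-value inequality on the disc);
* `|⨍_{S_δ} v_r| ≤ δ·Lv` (the first mode of the constant `v(0)` vanishes: `⨍ ⟪c, r̂⟫ = 0`);
* `|⨍_{S_δ} v_r² − ½‖v(0)‖²| ≤ (2‖v(0)‖ + δLv)·δLv` (`⨍ ⟪c, r̂⟫² = ½‖c‖²`).
These are the `δ`-boundary terms of the slice radial-momentum identity (I)/(H47a) as a theorem (ref3 F1): in the K⁗ assembly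
`δ = s⁻³/G_ℓ` and `Lp, Lv = O(G_ℓ·qℓ·s)`, so all three are `o(1)·s²`.

* `radialUnit_circleMap`, `inner_exp_mul_I`, `circleAverage_inner_radialUnit`, `circleAverage_sq_inner_radialUnit` — the two
  trigonometric means; `smallCircleLimit` — the Sketch47 text VERBATIM.

HONEST FRAMING: one-variable calculus on circles; nothing here proves the crux E (19832 OPEN), any door Target, or any Navier–Stokes
statement. [folklore]
-/

noncomputable section

open Set Metric MeasureTheory Real Complex
open scoped RealInnerProductSpace

set_option linter.dupNamespace false

namespace Summit.NavierStokesRegularity.NavierStokesRegularity.Theorems.PowerGaugeEulerLiouville.Condenser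

/-! ## The radial unit vector on a circle and the two trigonometric means -/

/-- On the circle of radius `δ > 0` about `0`, the radial unit vector `z/‖z‖` is `e^{iθ}`. [folklore] -/
theorem radialUnit_circleMap {δ : ℝ} (hδ : 0 < δ) (θ : ℝ) :
    (‖circleMap 0 δ θ‖⁻¹ : ℝ) • circleMap 0 δ θ = Complex.exp (θ * Complex.I) := by
  rw [norm_circleMap_zero, abs_of_pos hδ, circleMap_zero, Complex.real_smul, ← mul_assoc,
    ← Complex.ofReal_mul, inv_mul_cancel₀ hδ.ne', Complex.ofReal_one, one_mul]

/-- `⟪c, e^{iθ}⟫_ℝ = Re c · cos θ + Im c · sin θ`. [folklore] -/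
theorem inner_exp_mul_I (c : ℂ) (θ : ℝ) :
    ⟪c, Complex.exp (θ * Complex.I)⟫ = c.re * Real.cos θ + c.im * Real.sin θ := by
  rw [Complex.inner, Complex.mul_re, Complex.conj_re, Complex.conj_im, Complex.exp_ofReal_mul_I_re,
    Complex.exp_ofReal_mul_I_im]
  ring

/-- **First trigonometric mean**: `⨍_{S_δ} ⟪c, r̂⟫ = 0` (`δ > 0`). [folklore] -/
theorem circleAverage_inner_radialUnit (c : ℂ) {δ : ℝ} (hδ : 0 < δ) :
    Real.circleAverage (fun z : ℂ => ⟪c, (‖z‖⁻¹ : ℝ) • z⟫) 0 δ = 0 := by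
  rw [Real.circleAverage_def, smul_eq_mul]
  have hcongr : ∫ θ in (0 : ℝ)..2 * π, ⟪c, (‖circleMap 0 δ θ‖⁻¹ : ℝ) • circleMap 0 δ θ⟫ =
      ∫ θ in (0 : ℝ)..2 * π, (c.re * Real.cos θ + c.im * Real.sin θ) :=
    intervalIntegral.integral_congr fun θ _ => by simp only [radialUnit_circleMap hδ, inner_exp_mul_I]
  have hi : ∀ {f : ℝ → ℝ}, Continuous f → IntervalIntegrable f volume 0 (2 * π) := fun hf => hf.intervalIntegrable _ _
  rw [hcongr, intervalIntegral.integral_add (hi (by fun_prop)) (hi (by fun_prop)), intervalIntegral.integral_const_mul,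
    intervalIntegral.integral_const_mul, integral_cos, integral_sin, Real.sin_two_pi, Real.sin_zero, Real.cos_zero,
    Real.cos_two_pi]
  ring

/-- **Second trigonometric mean**: `⨍_{S_δ} ⟪c, r̂⟫² = ½‖c‖²` (`δ > 0`). [folklore] -/
theorem circleAverage_sq_inner_radialUnit (c : ℂ) {δ : ℝ} (hδ : 0 < δ) :
    Real.circleAverage (fun z : ℂ => ⟪c, (‖z‖⁻¹ : ℝ) • z⟫ ^ 2) 0 δ = (1 / 2) * ‖c‖ ^ 2 := by
  rw [Real.circleAverage_def, smul_eq_mul]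
  have hcongr : ∫ θ in (0 : ℝ)..2 * π, ⟪c, (‖circleMap 0 δ θ‖⁻¹ : ℝ) • circleMap 0 δ θ⟫ ^ 2 =
      ∫ θ in (0 : ℝ)..2 * π,
        (c.re ^ 2 * Real.cos θ ^ 2 + 2 * (c.re * c.im) * (Real.sin θ * Real.cos θ) + c.im ^ 2 * Real.sin θ ^ 2) :=
    intervalIntegral.integral_congr fun θ _ => by
      simp only [radialUnit_circleMap hδ, inner_exp_mul_I]; ring
  have hi : ∀ {f : ℝ → ℝ}, Continuous f → IntervalIntegrable f volume 0 (2 * π) := fun hf => hf.intervalIntegrable _ _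
  rw [hcongr, intervalIntegral.integral_add (hi (by fun_prop)) (hi (by fun_prop)),
    intervalIntegral.integral_add (hi (by fun_prop)) (hi (by fun_prop)),
    intervalIntegral.integral_const_mul, intervalIntegral.integral_const_mul, intervalIntegral.integral_const_mul,
    integral_cos_sq, integral_sin_sq, integral_sin_mul_cos₁, Real.sin_two_pi, Real.sin_zero, Real.cos_zero, Real.cos_two_pi,
    Complex.sq_norm, Complex.normSq_apply]
  have hπ : Real.pi ≠ 0 := Real.pi_ne_zero
  field_simp
  ring

/-! ## The small-circle limit -/

/-- **(M8) `NsregP2.R47.SmallCircleLimit`, binder-for-binder.**  See the module docstring. [folklore] -/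
theorem smallCircleLimit :
    ∀ (p : ℂ → ℝ) (v : ℂ → ℂ) (δ Lp Lv : ℝ), 0 < δ → ContDiff ℝ 1 p → ContDiff ℝ 1 v →
      (∀ z ∈ closedBall (0 : ℂ) δ, ‖fderiv ℝ p z‖ ≤ Lp) → (∀ z ∈ closedBall (0 : ℂ) δ, ‖fderiv ℝ v z‖ ≤ Lv) →
      |Real.circleAverage p 0 δ - p 0| ≤ δ * Lp ∧
        |Real.circleAverage (fun z : ℂ => ⟪v z, (‖z‖⁻¹ : ℝ) • z⟫) 0 δ| ≤ δ * Lv ∧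
        |Real.circleAverage (fun z : ℂ => ⟪v z, (‖z‖⁻¹ : ℝ) • z⟫ ^ 2) 0 δ - (1 / 2) * ‖v 0‖ ^ 2| ≤
          (2 * ‖v 0‖ + δ * Lv) * (δ * Lv) := by
  intro p v δ Lp Lv hδ hp hv hLp hLv
  have hpd : Differentiable ℝ p := hp.differentiable one_ne_zero
  have hvd : Differentiable ℝ v := hv.differentiable one_ne_zero
  -- mean-value inequality on the disc
  have hmvp : ∀ z ∈ closedBall (0 : ℂ) δ, ‖p z - p 0‖ ≤ Lp * ‖z‖ := fun z hz => by
    have h := (convex_closedBall (0 : ℂ) δ).norm_image_sub_le_of_norm_fderiv_le (fun w _ => hpd w) hLp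
      (mem_closedBall_self hδ.le) hz
    rwa [sub_zero] at h
  have hmvv : ∀ z ∈ closedBall (0 : ℂ) δ, ‖v z - v 0‖ ≤ Lv * ‖z‖ := fun z hz => by
    have h := (convex_closedBall (0 : ℂ) δ).norm_image_sub_le_of_norm_fderiv_le (fun w _ => hvd w) hLv
      (mem_closedBall_self hδ.le) hz
    rwa [sub_zero] at h
  -- points of the circle
  have hsph : ∀ z ∈ sphere (0 : ℂ) |δ|, ‖z‖ = δ := fun z hz => by
    rw [mem_sphere_zero_iff_norm, abs_of_pos hδ] at hz; exact hz
  have hsph' : ∀ z ∈ sphere (0 : ℂ) |δ|, z ∈ closedBall (0 : ℂ) δ := fun z hz =>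
    mem_closedBall_zero_iff.2 (hsph z hz).le
  have hLv0 : 0 ≤ Lv := (norm_nonneg _).trans (hLv 0 (mem_closedBall_self hδ.le))
  -- the radial unit vector field is continuous on the circle and has norm one there
  set ru : ℂ → ℂ := fun z => (‖z‖⁻¹ : ℝ) • z with hru
  have hru1 : ∀ z ∈ sphere (0 : ℂ) |δ|, ‖ru z‖ = 1 := fun z hz => by
    show ‖(‖z‖⁻¹ : ℝ) • z‖ = 1
    rw [norm_smul, norm_inv, norm_norm, hsph z hz, inv_mul_cancel₀ hδ.ne']
  have hruc : ContinuousOn ru (sphere (0 : ℂ) |δ|) := by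
    refine ((continuous_norm.continuousOn.inv₀ fun z hz => ?_).smul continuousOn_id)
    rw [hsph z hz]; exact hδ.ne'
  have hsphδ : sphere (0 : ℂ) |δ| = sphere (0 : ℂ) δ := by rw [abs_of_pos hδ]
  -- circle integrability of the players
  have hcip : CircleIntegrable p 0 δ := hp.continuous.continuousOn.circleIntegrable hδ.le
  have herr_c : ContinuousOn (fun z => ⟪v z - v 0, ru z⟫) (sphere (0 : ℂ) |δ|) :=
    ((hv.continuous.continuousOn.sub continuousOn_const).inner hruc)
  have hmain_c : ContinuousOn (fun z => ⟪v 0, ru z⟫) (sphere (0 : ℂ) |δ|) := continuousOn_const.inner hruc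
  have hci_err : CircleIntegrable (fun z => ⟪v z - v 0, ru z⟫) 0 δ := herr_c.circleIntegrable'
  have hci_main : CircleIntegrable (fun z => ⟪v 0, ru z⟫) 0 δ := hmain_c.circleIntegrable'
  -- the error term `e z = ⟪v z − v 0, r̂⟫` is `≤ δ Lv` on the circle
  have herr : ∀ z ∈ sphere (0 : ℂ) |δ|, |⟪v z - v 0, ru z⟫| ≤ δ * Lv := fun z hz => by
    calc |⟪v z - v 0, ru z⟫| ≤ ‖v z - v 0‖ * ‖ru z‖ := abs_real_inner_le_norm _ _
      _ ≤ Lv * ‖z‖ * 1 := by rw [hru1 z hz]; exact mul_le_mul_of_nonneg_right (hmvv z (hsph' z hz)) zero_le_one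
      _ = δ * Lv := by rw [hsph z hz]; ring
  have hmain : ∀ z ∈ sphere (0 : ℂ) |δ|, |⟪v 0, ru z⟫| ≤ ‖v 0‖ := fun z hz => by
    calc |⟪v 0, ru z⟫| ≤ ‖v 0‖ * ‖ru z‖ := abs_real_inner_le_norm _ _
      _ = ‖v 0‖ := by rw [hru1 z hz, mul_one]
  -- the decomposition `⟪v z, r̂⟫ = ⟪v 0, r̂⟫ + e z`
  have hsplit : ∀ z, ⟪v z, ru z⟫ = ⟪v 0, ru z⟫ + ⟪v z - v 0, ru z⟫ := fun z => by
    rw [inner_sub_left]; ring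
  refine ⟨?_, ?_, ?_⟩
  · -- (1) the pressure mean
    have h1 : Real.circleAverage p 0 δ - p 0 = Real.circleAverage (fun z => p z - p 0) 0 δ := by
      rw [Real.circleAverage_fun_sub hcip (circleIntegrable_const _ _ _), Real.circleAverage_const]
    rw [h1]
    refine Real.abs_circleAverage_le_circleAverage_abs.trans
      (Real.circleAverage_mono_on_of_le_circle (hcip.sub (circleIntegrable_const _ _ _)).abs fun z hz => ?_)
    show |p z - p 0| ≤ δ * Lp
    rw [← Real.norm_eq_abs]
    calc ‖p z - p 0‖ ≤ Lp * ‖z‖ := hmvp z (hsph' z hz)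
      _ = δ * Lp := by rw [hsph z hz, mul_comm]
  · -- (2) the radial-velocity mean
    have h2 : Real.circleAverage (fun z : ℂ => ⟪v z, ru z⟫) 0 δ = Real.circleAverage (fun z => ⟪v z - v 0, ru z⟫) 0 δ := by
      have e : (fun z : ℂ => ⟪v z, ru z⟫) = fun z => ⟪v 0, ru z⟫ + ⟪v z - v 0, ru z⟫ := funext hsplit
      rw [e, Real.circleAverage_fun_add hci_main hci_err, circleAverage_inner_radialUnit (v 0) hδ, zero_add]
    rw [h2]
    exact Real.abs_circleAverage_le_circleAverage_abs.trans
      (Real.circleAverage_mono_on_of_le_circle hci_err.abs fun z hz => herr z hz)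
  · -- (3) the squared radial-velocity mean
    have hci_sq : CircleIntegrable (fun z => ⟪v 0, ru z⟫ ^ 2) 0 δ := (hmain_c.pow 2).circleIntegrable'
    have hci_h : CircleIntegrable (fun z => ⟪v z - v 0, ru z⟫ * (2 * ⟪v 0, ru z⟫ + ⟪v z - v 0, ru z⟫)) 0 δ :=
      (herr_c.mul ((continuousOn_const.mul hmain_c).add herr_c)).circleIntegrable'
    have h3 : Real.circleAverage (fun z : ℂ => ⟪v z, ru z⟫ ^ 2) 0 δ - (1 / 2) * ‖v 0‖ ^ 2 =
        Real.circleAverage (fun z => ⟪v z - v 0, ru z⟫ * (2 * ⟪v 0, ru z⟫ + ⟪v z - v 0, ru z⟫)) 0 δ := by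
      have e : (fun z : ℂ => ⟪v z, ru z⟫ ^ 2) =
          fun z => ⟪v 0, ru z⟫ ^ 2 + ⟪v z - v 0, ru z⟫ * (2 * ⟪v 0, ru z⟫ + ⟪v z - v 0, ru z⟫) := by
        funext z; rw [hsplit z]; ring
      rw [e, Real.circleAverage_fun_add hci_sq hci_h, circleAverage_sq_inner_radialUnit (v 0) hδ]
      ring
    rw [h3]
    refine Real.abs_circleAverage_le_circleAverage_abs.trans
      (Real.circleAverage_mono_on_of_le_circle hci_h.abs fun z hz => ?_)
    show |⟪v z - v 0, ru z⟫ * (2 * ⟪v 0, ru z⟫ + ⟪v z - v 0, ru z⟫)| ≤ (2 * ‖v 0‖ + δ * Lv) * (δ * Lv)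
    rw [abs_mul, mul_comm]
    refine mul_le_mul ?_ (herr z hz) (abs_nonneg _) (by positivity)
    calc |2 * ⟪v 0, ru z⟫ + ⟪v z - v 0, ru z⟫| ≤ |2 * ⟪v 0, ru z⟫| + |⟪v z - v 0, ru z⟫| := abs_add_le _ _
      _ ≤ 2 * ‖v 0‖ + δ * Lv := by
          rw [abs_mul, abs_two]
          exact add_le_add (mul_le_mul_of_nonneg_left (hmain z hz) zero_le_two) (herr z hz)

end Summit.NavierStokesRegularity.NavierStokesRegularity.Theorems.PowerGaugeEulerLiouville.Condenser

end
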